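import Summits.HodgeConjecture.HodgeConjecture.Theorems.SixfoldTableXCensusWeilProductRowsGeneral
import Literature.AlgebraicGeometry.HodgeTheory.WeilTypeQuarticCMAlgebraHodgeLieSU
import Literature.AlgebraicGeometry.HodgeTheory.WeilTypeCMFieldHodgeGroupUEOfLie
import Literature.AlgebraicGeometry.HodgeTheory.CMFieldMixedPlaces
import HarnessLib

/-!
# TABLE X (dimension 6) — ROW 19 `g6.Y3xY3p` (`A ∼ Y₃ × Y₃′`, `Y ≄ Y′` simple type-IV threefolds with `End⁰ = K`, the diagonal
# `K` of Weil type `(3,3)`, signatures `(2,1)` ∕ `(1,2)`), EVERY MEMBER: the census nodes X2 ∕ X1 (+ domain, isogeny class) with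
# L17's displayed general-member hypothesis `hG` DISCHARGED — «special members = ∅» for row 19
# (cell `pub-hodgeav-hg6`, req-37 (A) Q2b; eng-4 g9, brick T3b (C); lead g4 GO 2026-08-29T07:47:19Z)

HONEST FRAMING. HC, `HC_AV` (stmt-1333), `HC_CM` (stmt-3052) and H2 are NOT proved and do not occur. X2 ∕ X1
(`TableX.SixfoldCodimTwoCensus` ∕ `TableX.SixfoldCodimThreeCensus`) stay `@[conjecture]` (OURS) — what is proved is the census
verdict «X2-at-`A` ∧ X1-at-`A`» for the members named. KERNEL ONLY: theorems over existing declarations; no definition, no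
`sorry`, no named fact; restates nothing.

WHAT THIS FILE DOES. L17 (`SixfoldTableXCensusWeilProductRowsGeneral`, `WeilERows.census_weilType_general_prod`) gives the census at
the PRODUCT Weil rows 17 ∕ 19 ∕ 22 for the GENERAL member, displaying the group hypothesis `hG` («every `u ∈ S(A)(h)(ℂ)` with
`det(u | W_K) = 1` lies in `Hg(A)(ℂ)|_{H¹}`»). For ROW 19 this hypothesis is now a THEOREM for EVERY member, by the ROW-11 CHAIN
WITH THE DIVISION HYPOTHESIS DELETED (eng-4 g9 finding, lead g4 2026-08-29T07:47:19Z): for `A ∼ Y × Y′` the endomorphism algebra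
`End⁰(A) = K × K = ℚ[φ_E]` is commutative of dimension `4 = 2|ι|` and single-generated (`φ_E` with four eigenvalues
`μ k₁, μ k₂, μ̄ k₁, μ̄ k₂`), the two `3`-blocks `W_{μ k₁} = W_K(Y)`, `W_{μ k₂} = W_K(Y′)` have signatures `(2,1)` ∕ `(1,2)` — pair
multiplicity `3`, `K`-signature `3`, hence BOTH MIXED (`AbelianVariety.eigenMultiplicity_ne_zero_of_cmField_of_add_eq`, p704326,
simplicity-free) — so
(i) the Lie theorem `IsWeilType.mem_hodgeLieC_of_commute_of_skew_of_trace_of_cmAlgebra_twoMixed` (`WeilTypeQuarticCMAlgebraHodgeLieSU`,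
R11-6b without simplicity, over the division-free R11-5 `CMHodgeGroupTwoMixedPlacesKWeilNoDiv`) gives B5a-E's `hSU`, and
(ii) the socket `IsWeilType.mem_hodgeGroupOne_of_mem_unitaryCentralizerGroup_of_cmField_of_hodgeLieC` (p698115, no simplicity
binder) gives `hG` — §0 `hG_of_kWeil_cmAlgebra_twoMixed` (= R11-7's `hG_of_kWeil_cmField_twoMixed` with `hS` struck).
§1 is L17's `census_weilType_general_prod` (+ `_of_isIsogenous`) with `hG` DELETED and the two-place member data added, `hmixed`
discharged; §2 = the HC readings ⟸ the DISPLAYED residue binders (`WeilSixfolds`; or Markman₆ + R-W6) via L16's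
`hodgeConjectureFor_weilType_generalE_of_weilSixfolds` ∕ `…_of_markman₆_nonsplit` (no domain hypothesis), exactly as row 11's
p703843. The domain clause `¬ 𝒞 A` of §1 is L17's (product structure, L9c). All declarations in L17's namespace `TableX.WeilERows`;
typed ≠ proved.

MEMBER DATA OF RECORD (row 19, every member): L17's product ∕ domain data (`Y` simple non-CM with `dim Y ≠ 4 ∨ rk End⁰ Y ≠ 4`,
`C` simple, `0 < dim C < 4`, `A ∼ Y × C`), `(A, φ)` of Weil type `(3, d)`, Milne's single-generator data for `C(A) ⊗ ℂ`
(`φ_E`, `hC`, `hdiag`, `J'`, `hJ'`, `hJQ`), `hφQ`, and the two-place data on the SAME `φ_E`: `dim_ℚ End⁰(A) = 2|ι|`, CM type `μ`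
with places `k₁ ≠ k₂` covering `ι`, pair multiplicity `3`, `K`-signature `n_{μ k₁} + n_{μ k₂} = 3`, `μ` the `K`-fibre. (These binders
are ALSO satisfied by the simple row-11 members — the theorem is the union «row 11 ∪ row 19» read through the product domain
clause; row 11's own census is `WeilLieRows.census_row11_kWeil''`.)

## References
* [MoonenZarhin1999LowDim] B. Moonen, Yu. Zarhin, Math. Ann. 315 (1999), Thm. 0.2, §2 (2.3), §5 (5.11) Case 1.
* [MoonenZarhin1998WeilClasses] B. Moonen, Yu. Zarhin, J. reine angew. Math. 496 (1998), §4 Remark (1).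
* [Milne1999LefschetzClasses] J. S. Milne, Duke Math. J. 96 (1999), §2 pp. 645–650, Thm. 3.2 and Cor. 4.5.
* [vanGeemen1994HodgeAV] B. van Geemen, LNM 1594 (1994), Thm. 6.12 and 4.9.
* [Deligne1982HodgeCycles] P. Deligne, LNM 900 (1982), I §3 Prop. 3.4 and 3.6.
-/

set_option linter.dupNamespace false

noncomputable section

open scoped TensorProduct
open CategoryTheory
open Literature.AlgebraicGeometry Literature.AlgebraicGeometry.Motives
open Literature.AlgebraicGeometry.Motives.AbelianVariety (IsIsogenous IsSimple)
open Literature.AlgebraicGeometry.Motives.HodgeStructure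
open Literature.AlgebraicGeometry.HodgeTheory
open Literature.AlgebraicGeometry.Milne1999
open Literature.AlgebraicGeometry.Deligne1982 (isOfHodgeType_one_one_of_isKaehlerClass_smul)
open Literature.AlgebraicGeometry.VanGeemen1994 (pullbackOne hodgeGroupOne detOnEigenspace hodgeClassSpan)
open Literature.AlgebraicTopology.SingularHomology
open Literature.Barriers.HodgeConjecture
open Literature.Geometry.Kaehler (HasHardLefschetzProperty)
open Summit.HodgeConjecture.HodgeConjecture.Ring2.ClassTargets
open Summit.HodgeConjecture.HodgeConjecture.Ring2.Motiv (ProdCMCell)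
open Summit.HodgeConjecture.HodgeConjecture.Ring2.Atlas (IsQuarticFieldTypeIVFourfold)

namespace Summit.HodgeConjecture.HodgeConjecture.TableX.WeilERows

/-! ## §0 The group hypothesis `hG` of L17 is a theorem for every member with two mixed `K`-places (rows 11 and 19) -/

section Socket

variable {A : AbelianVariety ℂ} {φ : A ⟶ A} {d : ℕ} {h : complexBetti A.X 2}

/-- **`hG` FOR EVERY MEMBER WITH `End⁰(A) = ℚ[φ_E]` OF DIMENSION `4` AND TWO MIXED `K`-PLACES — NO SIMPLICITY** (R11-7's
`WeilLieRows.hG_of_kWeil_cmField_twoMixed` with `hS` struck; generalisation, not a restatement): for `(A, φ)` of Weil type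
`(3, d)` with the member data of the module docstring and a rational class `h` with a Kähler multiple for which `φ^*` is a
`d`-similitude of `Q_h`, every `u ∈ S(A)(h)(ℂ)` with `det(u | W_K) = 1` lies in `Hg(A)(ℂ)|_{H¹}` — the simplicity-free Lie
theorem ∘ the `E ⊋ K` socket. Covers row 19 (`End⁰(A) = K × K`) and row 11. HC NOT proved.
[cite: MoonenZarhin1998WeilClasses, §4 Remark (1)] [cite: MoonenZarhin1999LowDim, §2 (2.3) and §5 (5.11)]
[cite: Deligne1982HodgeCycles, I §3 Prop. 3.4 and 3.6] -/
theorem hG_of_kWeil_cmAlgebra_twoMixed {ι : Type} [Fintype ι] [DecidableEq ι]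
    (hW : IsWeilType A φ 3 d) (φE : A ⟶ A) (hE : Module.finrank ℚ A.endAlgebra = 2 * Fintype.card ι)
    (μ : ι → ℂ) (hinj : Function.Injective μ) (hdist : ∀ k k', μ k' ≠ starRingEnd ℂ (μ k))
    (hmult : ∀ k, eigenMultiplicity A φE (μ k) + eigenMultiplicity A φE (starRingEnd ℂ (μ k)) = 3)
    (hmixed : ∀ k, eigenMultiplicity A φE (μ k) ≠ 0 ∧ eigenMultiplicity A φE (starRingEnd ℂ (μ k)) ≠ 0)
    (k₁ k₂ : ι) (hk₁₂ : k₁ ≠ k₂) (hι : ∀ k, k = k₁ ∨ k = k₂)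
    (hKW : eigenMultiplicity A φE (μ k₁) + eigenMultiplicity A φE (μ k₂) = 3)
    (hKE : ∀ k, Module.End.eigenspace (((bettiCohomology.map φE.hom.hom.hom 1).hom).baseChange ℂ) (μ k) ≤
      Module.End.eigenspace (((bettiCohomology.map φ.hom.hom.hom 1).hom).baseChange ℂ) (Complex.I * (Real.sqrt d : ℂ)))
    (hKE' : ∀ k, Module.End.eigenspace (((bettiCohomology.map φE.hom.hom.hom 1).hom).baseChange ℂ) (starRingEnd ℂ (μ k)) ≤
      Module.End.eigenspace (((bettiCohomology.map φ.hom.hom.hom 1).hom).baseChange ℂ) (-(Complex.I * (Real.sqrt d : ℂ))))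
    (hQ : IsRationalClass h) (hK : ∃ s : ℝ, 0 < s ∧ IsKaehlerClass A.dim A.X ((s : ℂ) • h))
    (hφQ : ∀ x y, polarizationPairingOne A.X h (A.dim - 1) (pullbackOne A φ x) (pullbackOne A φ y) =
      (d : ℂ) • polarizationPairingOne A.X h (A.dim - 1) x y) :
    ∀ (u : complexBetti A.X 1 ≃ₗ[ℂ] complexBetti A.X 1) (hu : u ∈ unitaryCentralizerGroup A h),
      detOnEigenspace u (pullbackOne A φ) (fun x ↦ (mem_centralizerGroup_iff.1 hu.1) φ x)
        (Complex.I * (Real.sqrt d : ℂ)) = 1 → u ∈ hodgeGroupOne A.dim A.X := by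
  haveI : HodgeTensorFacts.{0, 0} := hodgeTensorFacts_holds
  obtain ⟨ψ⟩ := BettiUniverse.hodge_isPolarizable exists_isReal_hodgeModel_holds
    (AbelianVariety.isSmoothProjective_holds (A := A)) 1
  have hX : IsSmoothProjective A.dim A.X := AbelianVariety.isSmoothProjective_holds
  -- `|ι| = 2`, `dim A = |ι| · 3`
  have hcard2 : Fintype.card ι = 2 := by
    have huniv : (Finset.univ : Finset ι) = {k₁, k₂} := by
      ext k
      simp only [Finset.mem_univ, Finset.mem_insert, Finset.mem_singleton, true_iff]
      exact hι k
    rw [← Finset.card_univ, huniv, Finset.card_insert_of_notMem (by rw [Finset.mem_singleton]; exact hk₁₂),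
      Finset.card_singleton]
  have hdim : A.dim = Fintype.card ι * 3 := by rw [hW.dim_eq, hcard2]
  -- `h` is a rational `(1,1)`-class; `Q_h` is non-degenerate on `H¹` (hard Lefschetz)
  obtain ⟨s, hs, hsK⟩ := hK
  have h11 : IsOfHodgeType A.dim A.X (2 * 1) 1 1 h := isOfHodgeType_one_one_of_isKaehlerClass_smul ⟨s, hs.ne', hsK⟩
  have hh : h ∈ hodgeClassSpan A.dim A.X 1 := Submodule.subset_span ⟨hQ, h11⟩
  have hHL : HasHardLefschetzProperty h A.dim := by
    have h1 := HasHardLefschetzProperty.smul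
      (hsK.hasHardLefschetzProperty hX fun _ ↦ Motives.hasHardLefschetzProperty_kaehlerClass_holds)
      (inv_ne_zero (Complex.ofReal_ne_zero.2 hs.ne'))
    rwa [smul_smul, inv_mul_cancel₀ (Complex.ofReal_ne_zero.2 hs.ne'), one_smul] at h1
  have hnd : ∀ x : complexBetti A.X 1, (∀ y, polarizationPairingOne A.X h (A.dim - 1) x y = 0) → x = 0 :=
    fun x hx => eq_zero_of_forall_polarizationPairingOne_eq_zero_of_hasHardLefschetzProperty
      (by rw [hW.dim_eq]; norm_num) hHL hx
  exact fun u hu hdet ↦ hW.mem_hodgeGroupOne_of_mem_unitaryCentralizerGroup_of_cmField_of_hodgeLieC φE hE μ hinj hdist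
    three_pos hmult hdim hKE hKE' ψ (hW.mem_hodgeLieC_of_commute_of_skew_of_trace_of_cmAlgebra_twoMixed φE hE μ hinj hdist hmult
      hmixed k₁ k₂ hk₁₂ hι hKW hKE hKE' ψ) hh hnd hφQ u hu hdet

/-- **BOTH PLACES ARE MIXED** for the two-place member data (pair multiplicity `3`, `K`-signature `3`): the tree's
`AbelianVariety.eigenMultiplicity_ne_zero_of_cmField_of_add_eq` (p704326; no simplicity, no field hypothesis) at `n₀ = 3`.
[cite: Deligne1982HodgeCycles, I §3 Ex. 3.7] [cite: MoonenZarhin1999LowDim, §2 (2.3)] -/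
theorem mixed_of_kWeil_cmAlgebra {ι : Type} [Fintype ι] [DecidableEq ι]
    (hW : IsWeilType A φ 3 d) (φE : A ⟶ A) (hE : Module.finrank ℚ A.endAlgebra = 2 * Fintype.card ι)
    (μ : ι → ℂ) (hinj : Function.Injective μ) (hdist : ∀ k k', μ k' ≠ starRingEnd ℂ (μ k))
    (hmult : ∀ k, eigenMultiplicity A φE (μ k) + eigenMultiplicity A φE (starRingEnd ℂ (μ k)) = 3)
    (k₁ k₂ : ι) (hk₁₂ : k₁ ≠ k₂) (hι : ∀ k, k = k₁ ∨ k = k₂)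
    (hKW : eigenMultiplicity A φE (μ k₁) + eigenMultiplicity A φE (μ k₂) = 3) (k : ι) :
    eigenMultiplicity A φE (μ k) ≠ 0 ∧ eigenMultiplicity A φE (starRingEnd ℂ (μ k)) ≠ 0 := by
  haveI : HodgeTensorFacts.{0, 0} := hodgeTensorFacts_holds
  have hcard2 : Fintype.card ι = 2 := by
    have huniv : (Finset.univ : Finset ι) = {k₁, k₂} := by
      ext k'
      simp only [Finset.mem_univ, Finset.mem_insert, Finset.mem_singleton, true_iff]
      exact hι k'
    rw [← Finset.card_univ, huniv, Finset.card_insert_of_notMem (by rw [Finset.mem_singleton]; exact hk₁₂),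
      Finset.card_singleton]
  have hdim : A.dim = Fintype.card ι * 3 := by rw [hW.dim_eq, hcard2]
  exact AbelianVariety.eigenMultiplicity_ne_zero_of_cmField_of_add_eq A φE hE μ hinj hdist (by norm_num) hmult hdim k₁ k₂ hι
    hKW k

end Socket

/-! ## §1 Row 19, every member: the census and the isogeny class, `hG` and `hmixed` discharged -/

section Census

variable (A : AbelianVariety ℂ) (φ : A ⟶ A) (d : ℕ) {h : complexBetti A.X 2}

/-- **TABLE X ROW 19 `g6.Y3xY3p` — EVERY MEMBER, KERNEL VERDICT WITH DOMAIN MEMBERSHIP, NO Hodge-group hypothesis displayed.**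
L17's `census_weilType_general_prod` with its displayed general-member hypothesis `hG` REPLACED by the two-place member data
(module docstring) on Milne's generator `φ_E` and DISCHARGED by §0 (`hmixed` by `mixed_of_kWeil_cmAlgebra`). For `A ∼ Y × C`
with `Y` simple non-CM (`dim Y ≠ 4 ∨ rk End⁰ Y ≠ 4`), `C` simple, `0 < dim C < 4` — row 19: `Y = Y₃`, `C = Y₃′` —, `(A, φ)` of
Weil type `(3, d)`: `(dim A = 6 ∧ ¬ 𝒞 A) ∧` X2-at-`A` `∧` X1-at-`A`. «Special members = ∅» for row 19. HC NOT proved.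
[cite: MoonenZarhin1999LowDim, Thm. 0.2, §2 (2.3) and §5 (5.11)] [cite: Milne1999LefschetzClasses, Thm. 3.2 and Cor. 4.5]
[cite: vanGeemen1994HodgeAV, Thm. 6.12 and 4.9] -/
theorem census_row19_kWeil_prod {Y C : AbelianVariety ℂ} (hYs : Y.IsSimple) (hYcm : ¬ IsOfCMType Y)
    (h0Y : 0 < Y.dim) (hY : Y.dim ≠ 4 ∨ Module.finrank ℚ Y.endAlgebra ≠ 4) (hCs : C.IsSimple) (h0C : 0 < C.dim)
    (hC4 : C.dim < 4) (hAYC : IsIsogenous A (Y.prod C)) (hW : IsWeilType A φ 3 d)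
    (φE : A ⟶ A) (hC : centralizerAlgebra A = Subalgebra.centralizer ℂ {pullbackOne A φE})
    (hdiag : ⨆ μ : ℂ, Module.End.eigenspace (pullbackOne A φE) μ = ⊤)
    (hQ : IsRationalClass h) (hK : ∃ s : ℝ, 0 < s ∧ IsKaehlerClass A.dim A.X ((s : ℂ) • h))
    (J' : Module.End ℂ (complexBetti A.X 1))
    (hJ' : J' ∈ Subalgebra.centralizer ℂ (centralizerAlgebra A : Set (Module.End ℂ (complexBetti A.X 1))))
    (hJQ : ∀ x y : complexBetti A.X 1,
      polarizationPairingOne A.X h (A.dim - 1) (pullbackOne A φE x) y =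
        polarizationPairingOne A.X h (A.dim - 1) x (J' y))
    (hφQ : ∀ x y, polarizationPairingOne A.X h (A.dim - 1) (pullbackOne A φ x) (pullbackOne A φ y) =
      (d : ℂ) • polarizationPairingOne A.X h (A.dim - 1) x y)
    {ι : Type} [Fintype ι] [DecidableEq ι]
    (hE : Module.finrank ℚ A.endAlgebra = 2 * Fintype.card ι)
    (μ : ι → ℂ) (hinj : Function.Injective μ) (hdist : ∀ k k', μ k' ≠ starRingEnd ℂ (μ k))
    (hmult : ∀ k, eigenMultiplicity A φE (μ k) + eigenMultiplicity A φE (starRingEnd ℂ (μ k)) = 3)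
    (k₁ k₂ : ι) (hk₁₂ : k₁ ≠ k₂) (hι : ∀ k, k = k₁ ∨ k = k₂)
    (hKW : eigenMultiplicity A φE (μ k₁) + eigenMultiplicity A φE (μ k₂) = 3)
    (hKE : ∀ k, Module.End.eigenspace (((bettiCohomology.map φE.hom.hom.hom 1).hom).baseChange ℂ) (μ k) ≤
      Module.End.eigenspace (((bettiCohomology.map φ.hom.hom.hom 1).hom).baseChange ℂ) (Complex.I * (Real.sqrt d : ℂ)))
    (hKE' : ∀ k, Module.End.eigenspace (((bettiCohomology.map φE.hom.hom.hom 1).hom).baseChange ℂ) (starRingEnd ℂ (μ k)) ≤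
      Module.End.eigenspace (((bettiCohomology.map φ.hom.hom.hom 1).hom).baseChange ℂ) (-(Complex.I * (Real.sqrt d : ℂ)))) :
    (A.dim = 6 ∧ ¬ (IsOfCMType A ∨ ProdCMCell IsQuarticFieldTypeIVFourfold (fun Z ↦ Z.dim = 2) A)) ∧
    (∀ c : complexBetti A.X (2 * 2), IsRationalClass c → IsOfHodgeType A.dim A.X (2 * 2) 2 2 c →
      c ∈ divisorClassesSpan A.X A.dim 2 ⊔ Submodule.span ℂ {w' : complexBetti A.X (2 * 2) |
        ∃ (C : AbelianVariety ℂ) (g : A.X ⟶ C.X) (w : complexBetti C.X (2 * 2)), C.dim < A.dim ∧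
          IsRationalClass w ∧ IsOfHodgeType C.dim C.X (2 * 2) 2 2 w ∧ w' = complexBetti.map g (2 * 2) w}) ∧
    (∀ c : complexBetti A.X (2 * 3), IsRationalClass c → IsOfHodgeType A.dim A.X (2 * 3) 3 3 c →
      c ∈ divisorClassesSpan A.X A.dim 3 ⊔ Submodule.span ℂ {w' : complexBetti A.X (2 * 3) |
          ∃ (a : complexBetti A.X (2 * 2)) (b : complexBetti A.X (2 * 1)),
            IsRationalClass a ∧ IsOfHodgeType A.dim A.X (2 * 2) 2 2 a ∧ IsRationalClass b ∧
            IsOfHodgeType A.dim A.X (2 * 1) 1 1 b ∧ w' = cupProduct (two_mul_add_two_mul 2 1) a b} ⊔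
        Submodule.span ℂ {w' : complexBetti A.X (2 * 3) |
          ∃ (C : AbelianVariety ℂ) (g : A.X ⟶ C.X) (w : complexBetti C.X (2 * 3)), C.dim < A.dim ∧
            IsRationalClass w ∧ IsOfHodgeType C.dim C.X (2 * 3) 3 3 w ∧ w' = complexBetti.map g (2 * 3) w} ⊔
        Submodule.span ℂ {w' : complexBetti A.X (2 * 3) |
          ∃ (B' : AbelianVariety ℂ) (g : A.X ⟶ B'.X) (d : ℕ) (ψ : B' ⟶ B') (w : complexBetti B'.X (2 * 3)),
            B'.dim = 6 ∧ 0 < d ∧ ψ ≫ ψ = -(d • 𝟙 B') ∧ IsRationalClass w ∧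
            IsOfHodgeType B'.dim B'.X (2 * 3) 3 3 w ∧ w ∈ weilClassesOf B' ψ 3 d ∧
            w' = complexBetti.map g (2 * 3) w}) := by
  haveI : HodgeTensorFacts.{0, 0} := hodgeTensorFacts_holds
  exact census_weilType_general_prod A φ d hYs hYcm h0Y hY hCs h0C hC4 hAYC hW φE hC hdiag hQ hK J' hJ' hJQ hφQ
    (hG_of_kWeil_cmAlgebra_twoMixed hW φE hE μ hinj hdist hmult
      (mixed_of_kWeil_cmAlgebra hW φE hE μ hinj hdist hmult k₁ k₂ hk₁₂ hι hKW) k₁ k₂ hk₁₂ hι hKW hKE hKE' hQ hK hφQ)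

/-- **Row 19, every member, on the whole ISOGENY CLASS of `A`** (L17's `…_of_isIsogenous` with `hG` discharged).
[cite: MoonenZarhin1999LowDim, Thm. 0.2 and §5 (5.1), (5.11)] [cite: Milne1999LefschetzClasses, Thm. 3.2 and Cor. 4.5]
[cite: vanGeemen1994HodgeAV, Lemma 3.7 and Thm. 6.12] -/
theorem census_row19_kWeil_prod_of_isIsogenous {A' Y C : AbelianVariety ℂ} (hYs : Y.IsSimple) (hYcm : ¬ IsOfCMType Y)
    (h0Y : 0 < Y.dim) (hY : Y.dim ≠ 4 ∨ Module.finrank ℚ Y.endAlgebra ≠ 4) (hCs : C.IsSimple) (h0C : 0 < C.dim)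
    (hC4 : C.dim < 4) (hAYC : IsIsogenous A (Y.prod C)) (hW : IsWeilType A φ 3 d)
    (φE : A ⟶ A) (hC : centralizerAlgebra A = Subalgebra.centralizer ℂ {pullbackOne A φE})
    (hdiag : ⨆ μ : ℂ, Module.End.eigenspace (pullbackOne A φE) μ = ⊤)
    (hQ : IsRationalClass h) (hK : ∃ s : ℝ, 0 < s ∧ IsKaehlerClass A.dim A.X ((s : ℂ) • h))
    (J' : Module.End ℂ (complexBetti A.X 1))
    (hJ' : J' ∈ Subalgebra.centralizer ℂ (centralizerAlgebra A : Set (Module.End ℂ (complexBetti A.X 1))))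
    (hJQ : ∀ x y : complexBetti A.X 1,
      polarizationPairingOne A.X h (A.dim - 1) (pullbackOne A φE x) y =
        polarizationPairingOne A.X h (A.dim - 1) x (J' y))
    (hφQ : ∀ x y, polarizationPairingOne A.X h (A.dim - 1) (pullbackOne A φ x) (pullbackOne A φ y) =
      (d : ℂ) • polarizationPairingOne A.X h (A.dim - 1) x y)
    {ι : Type} [Fintype ι] [DecidableEq ι]
    (hE : Module.finrank ℚ A.endAlgebra = 2 * Fintype.card ι)
    (μ : ι → ℂ) (hinj : Function.Injective μ) (hdist : ∀ k k', μ k' ≠ starRingEnd ℂ (μ k))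
    (hmult : ∀ k, eigenMultiplicity A φE (μ k) + eigenMultiplicity A φE (starRingEnd ℂ (μ k)) = 3)
    (k₁ k₂ : ι) (hk₁₂ : k₁ ≠ k₂) (hι : ∀ k, k = k₁ ∨ k = k₂)
    (hKW : eigenMultiplicity A φE (μ k₁) + eigenMultiplicity A φE (μ k₂) = 3)
    (hKE : ∀ k, Module.End.eigenspace (((bettiCohomology.map φE.hom.hom.hom 1).hom).baseChange ℂ) (μ k) ≤
      Module.End.eigenspace (((bettiCohomology.map φ.hom.hom.hom 1).hom).baseChange ℂ) (Complex.I * (Real.sqrt d : ℂ)))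
    (hKE' : ∀ k, Module.End.eigenspace (((bettiCohomology.map φE.hom.hom.hom 1).hom).baseChange ℂ) (starRingEnd ℂ (μ k)) ≤
      Module.End.eigenspace (((bettiCohomology.map φ.hom.hom.hom 1).hom).baseChange ℂ) (-(Complex.I * (Real.sqrt d : ℂ))))
    (hA'A : IsIsogenous A' A) :
    (A'.dim = 6 ∧ ¬ (IsOfCMType A' ∨ ProdCMCell IsQuarticFieldTypeIVFourfold (fun Z ↦ Z.dim = 2) A')) ∧
    (∀ c : complexBetti A'.X (2 * 2), IsRationalClass c → IsOfHodgeType A'.dim A'.X (2 * 2) 2 2 c →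
      c ∈ divisorClassesSpan A'.X A'.dim 2 ⊔ Submodule.span ℂ {w' : complexBetti A'.X (2 * 2) |
        ∃ (C : AbelianVariety ℂ) (g : A'.X ⟶ C.X) (w : complexBetti C.X (2 * 2)), C.dim < A'.dim ∧
          IsRationalClass w ∧ IsOfHodgeType C.dim C.X (2 * 2) 2 2 w ∧ w' = complexBetti.map g (2 * 2) w}) ∧
    (∀ c : complexBetti A'.X (2 * 3), IsRationalClass c → IsOfHodgeType A'.dim A'.X (2 * 3) 3 3 c →
      c ∈ divisorClassesSpan A'.X A'.dim 3 ⊔ Submodule.span ℂ {w' : complexBetti A'.X (2 * 3) |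
          ∃ (a : complexBetti A'.X (2 * 2)) (b : complexBetti A'.X (2 * 1)),
            IsRationalClass a ∧ IsOfHodgeType A'.dim A'.X (2 * 2) 2 2 a ∧ IsRationalClass b ∧
            IsOfHodgeType A'.dim A'.X (2 * 1) 1 1 b ∧ w' = cupProduct (two_mul_add_two_mul 2 1) a b} ⊔
        Submodule.span ℂ {w' : complexBetti A'.X (2 * 3) |
          ∃ (C : AbelianVariety ℂ) (g : A'.X ⟶ C.X) (w : complexBetti C.X (2 * 3)), C.dim < A'.dim ∧
            IsRationalClass w ∧ IsOfHodgeType C.dim C.X (2 * 3) 3 3 w ∧ w' = complexBetti.map g (2 * 3) w} ⊔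
        Submodule.span ℂ {w' : complexBetti A'.X (2 * 3) |
          ∃ (B' : AbelianVariety ℂ) (g : A'.X ⟶ B'.X) (d : ℕ) (ψ : B' ⟶ B') (w : complexBetti B'.X (2 * 3)),
            B'.dim = 6 ∧ 0 < d ∧ ψ ≫ ψ = -(d • 𝟙 B') ∧ IsRationalClass w ∧
            IsOfHodgeType B'.dim B'.X (2 * 3) 3 3 w ∧ w ∈ weilClassesOf B' ψ 3 d ∧
            w' = complexBetti.map g (2 * 3) w}) := by
  haveI : HodgeTensorFacts.{0, 0} := hodgeTensorFacts_holds
  exact census_weilType_general_prod_of_isIsogenous A φ d hYs hYcm h0Y hY hCs h0C hC4 hAYC hW φE hC hdiag hQ hK J' hJ' hJQ hφQ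
    (hG_of_kWeil_cmAlgebra_twoMixed hW φE hE μ hinj hdist hmult
      (mixed_of_kWeil_cmAlgebra hW φE hE μ hinj hdist hmult k₁ k₂ hk₁₂ hι hKW) k₁ k₂ hk₁₂ hι hKW hKE hKE' hQ hK hφQ) hA'A


/-! ## §2 HC at every such member ⟸ the DISPLAYED residue binders (`WeilSixfolds`, or {Markman₆, R-W6}) -/

/-- **HC for every member with the two-place `K`-Weil data (rows 19 and 11) ⟸ the ladder item `WeilSixfolds`
(stmt-HodgeConjecture-2524, DISPLAYED, not asserted)** — L16's `hodgeConjectureFor_weilType_generalE_of_weilSixfolds` (no domain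
hypothesis) with `hG` discharged by §0. HC NOT proved unconditionally. [cite: vanGeemen1994HodgeAV, 2.4 and Thm. 6.12]
[cite: Milne1999LefschetzClasses, Cor. 4.5] [cite: MoonenZarhin1999LowDim, Thm. 0.2, (2.3) and (5.11)] -/
theorem hodgeConjectureFor_row19_kWeil_of_weilSixfolds (hW₆ : Theses.SevenfoldWeilCensus.WeilSixfolds)
    (hW : IsWeilType A φ 3 d)
    (φE : A ⟶ A) (hC : centralizerAlgebra A = Subalgebra.centralizer ℂ {pullbackOne A φE})
    (hdiag : ⨆ μ : ℂ, Module.End.eigenspace (pullbackOne A φE) μ = ⊤)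
    (hQ : IsRationalClass h) (hK : ∃ s : ℝ, 0 < s ∧ IsKaehlerClass A.dim A.X ((s : ℂ) • h))
    (J' : Module.End ℂ (complexBetti A.X 1))
    (hJ' : J' ∈ Subalgebra.centralizer ℂ (centralizerAlgebra A : Set (Module.End ℂ (complexBetti A.X 1))))
    (hJQ : ∀ x y : complexBetti A.X 1,
      polarizationPairingOne A.X h (A.dim - 1) (pullbackOne A φE x) y =
        polarizationPairingOne A.X h (A.dim - 1) x (J' y))
    (hφQ : ∀ x y, polarizationPairingOne A.X h (A.dim - 1) (pullbackOne A φ x) (pullbackOne A φ y) =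
      (d : ℂ) • polarizationPairingOne A.X h (A.dim - 1) x y)
    {ι : Type} [Fintype ι] [DecidableEq ι]
    (hE : Module.finrank ℚ A.endAlgebra = 2 * Fintype.card ι)
    (μ : ι → ℂ) (hinj : Function.Injective μ) (hdist : ∀ k k', μ k' ≠ starRingEnd ℂ (μ k))
    (hmult : ∀ k, eigenMultiplicity A φE (μ k) + eigenMultiplicity A φE (starRingEnd ℂ (μ k)) = 3)
    (k₁ k₂ : ι) (hk₁₂ : k₁ ≠ k₂) (hι : ∀ k, k = k₁ ∨ k = k₂)
    (hKW : eigenMultiplicity A φE (μ k₁) + eigenMultiplicity A φE (μ k₂) = 3)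
    (hKE : ∀ k, Module.End.eigenspace (((bettiCohomology.map φE.hom.hom.hom 1).hom).baseChange ℂ) (μ k) ≤
      Module.End.eigenspace (((bettiCohomology.map φ.hom.hom.hom 1).hom).baseChange ℂ) (Complex.I * (Real.sqrt d : ℂ)))
    (hKE' : ∀ k, Module.End.eigenspace (((bettiCohomology.map φE.hom.hom.hom 1).hom).baseChange ℂ) (starRingEnd ℂ (μ k)) ≤
      Module.End.eigenspace (((bettiCohomology.map φ.hom.hom.hom 1).hom).baseChange ℂ) (-(Complex.I * (Real.sqrt d : ℂ)))) :
    HodgeConjectureFor A.dim A.X := by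
  haveI : HodgeTensorFacts.{0, 0} := hodgeTensorFacts_holds
  exact hodgeConjectureFor_weilType_generalE_of_weilSixfolds A φ d hW₆ hW φE hC hdiag hQ hK J' hJ' hJQ hφQ
    (hG_of_kWeil_cmAlgebra_twoMixed hW φE hE μ hinj hdist hmult
      (mixed_of_kWeil_cmAlgebra hW φE hE μ hinj hdist hmult k₁ k₂ hk₁₂ hι hKW) k₁ k₂ hk₁₂ hι hKW hKE hKE' hQ hK hφQ)

/-- **… and on the whole isogeny class** (`HodgeConjectureFor.of_isIsogenous`). `WeilSixfolds` displayed; HC NOT proved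
unconditionally. [cite: vanGeemen1994HodgeAV, Lemma 3.7 and Thm. 6.12] -/
theorem hodgeConjectureFor_of_isIsogenous_row19_kWeil_of_weilSixfolds {A' : AbelianVariety ℂ}
    (hW₆ : Theses.SevenfoldWeilCensus.WeilSixfolds) (hW : IsWeilType A φ 3 d)
    (φE : A ⟶ A) (hC : centralizerAlgebra A = Subalgebra.centralizer ℂ {pullbackOne A φE})
    (hdiag : ⨆ μ : ℂ, Module.End.eigenspace (pullbackOne A φE) μ = ⊤)
    (hQ : IsRationalClass h) (hK : ∃ s : ℝ, 0 < s ∧ IsKaehlerClass A.dim A.X ((s : ℂ) • h))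
    (J' : Module.End ℂ (complexBetti A.X 1))
    (hJ' : J' ∈ Subalgebra.centralizer ℂ (centralizerAlgebra A : Set (Module.End ℂ (complexBetti A.X 1))))
    (hJQ : ∀ x y : complexBetti A.X 1,
      polarizationPairingOne A.X h (A.dim - 1) (pullbackOne A φE x) y =
        polarizationPairingOne A.X h (A.dim - 1) x (J' y))
    (hφQ : ∀ x y, polarizationPairingOne A.X h (A.dim - 1) (pullbackOne A φ x) (pullbackOne A φ y) =
      (d : ℂ) • polarizationPairingOne A.X h (A.dim - 1) x y)
    {ι : Type} [Fintype ι] [DecidableEq ι]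
    (hE : Module.finrank ℚ A.endAlgebra = 2 * Fintype.card ι)
    (μ : ι → ℂ) (hinj : Function.Injective μ) (hdist : ∀ k k', μ k' ≠ starRingEnd ℂ (μ k))
    (hmult : ∀ k, eigenMultiplicity A φE (μ k) + eigenMultiplicity A φE (starRingEnd ℂ (μ k)) = 3)
    (k₁ k₂ : ι) (hk₁₂ : k₁ ≠ k₂) (hι : ∀ k, k = k₁ ∨ k = k₂)
    (hKW : eigenMultiplicity A φE (μ k₁) + eigenMultiplicity A φE (μ k₂) = 3)
    (hKE : ∀ k, Module.End.eigenspace (((bettiCohomology.map φE.hom.hom.hom 1).hom).baseChange ℂ) (μ k) ≤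
      Module.End.eigenspace (((bettiCohomology.map φ.hom.hom.hom 1).hom).baseChange ℂ) (Complex.I * (Real.sqrt d : ℂ)))
    (hKE' : ∀ k, Module.End.eigenspace (((bettiCohomology.map φE.hom.hom.hom 1).hom).baseChange ℂ) (starRingEnd ℂ (μ k)) ≤
      Module.End.eigenspace (((bettiCohomology.map φ.hom.hom.hom 1).hom).baseChange ℂ) (-(Complex.I * (Real.sqrt d : ℂ))))
    (hA'A : IsIsogenous A' A) : HodgeConjectureFor A'.dim A'.X :=
  HodgeConjectureFor.of_isIsogenous hA'A
    (hodgeConjectureFor_row19_kWeil_of_weilSixfolds A φ d hW₆ hW φE hC hdiag hQ hK J' hJ' hJQ hφQ hE μ hinj hdist hmult k₁ k₂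
      hk₁₂ hι hKW hKE hKE')

/-- **HC for everything isogenous to such a member ⟸ {Markman₆ (preprint, UNREFEREED), R-W6 (OPEN)}, both DISPLAYED**
(L16's `hodgeConjectureFor_weilType_generalE_of_markman₆_nonsplit` with `hG` discharged by §0). HC NOT proved unconditionally.
[cite: Markman2025SecantWeil, Thm. 1.5.1 (preprint, unrefereed)] [claim: Markman2025SurveySecant, status: under-review]
[cite: vanGeemen1994HodgeAV, Lemma 3.7 and Thm. 6.12] -/
theorem hodgeConjectureFor_of_isIsogenous_row19_kWeil_of_markman₆_nonsplit {A' : AbelianVariety ℂ}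
    (hMark₆ : Markman2025_weilClasses_algebraic_hyperbolicSixfold) (hRW6 : WeilTypeLadder.NonsplitSixfolds)
    (hW : IsWeilType A φ 3 d)
    (φE : A ⟶ A) (hC : centralizerAlgebra A = Subalgebra.centralizer ℂ {pullbackOne A φE})
    (hdiag : ⨆ μ : ℂ, Module.End.eigenspace (pullbackOne A φE) μ = ⊤)
    (hQ : IsRationalClass h) (hK : ∃ s : ℝ, 0 < s ∧ IsKaehlerClass A.dim A.X ((s : ℂ) • h))
    (J' : Module.End ℂ (complexBetti A.X 1))
    (hJ' : J' ∈ Subalgebra.centralizer ℂ (centralizerAlgebra A : Set (Module.End ℂ (complexBetti A.X 1))))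
    (hJQ : ∀ x y : complexBetti A.X 1,
      polarizationPairingOne A.X h (A.dim - 1) (pullbackOne A φE x) y =
        polarizationPairingOne A.X h (A.dim - 1) x (J' y))
    (hφQ : ∀ x y, polarizationPairingOne A.X h (A.dim - 1) (pullbackOne A φ x) (pullbackOne A φ y) =
      (d : ℂ) • polarizationPairingOne A.X h (A.dim - 1) x y)
    {ι : Type} [Fintype ι] [DecidableEq ι]
    (hE : Module.finrank ℚ A.endAlgebra = 2 * Fintype.card ι)
    (μ : ι → ℂ) (hinj : Function.Injective μ) (hdist : ∀ k k', μ k' ≠ starRingEnd ℂ (μ k))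
    (hmult : ∀ k, eigenMultiplicity A φE (μ k) + eigenMultiplicity A φE (starRingEnd ℂ (μ k)) = 3)
    (k₁ k₂ : ι) (hk₁₂ : k₁ ≠ k₂) (hι : ∀ k, k = k₁ ∨ k = k₂)
    (hKW : eigenMultiplicity A φE (μ k₁) + eigenMultiplicity A φE (μ k₂) = 3)
    (hKE : ∀ k, Module.End.eigenspace (((bettiCohomology.map φE.hom.hom.hom 1).hom).baseChange ℂ) (μ k) ≤
      Module.End.eigenspace (((bettiCohomology.map φ.hom.hom.hom 1).hom).baseChange ℂ) (Complex.I * (Real.sqrt d : ℂ)))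
    (hKE' : ∀ k, Module.End.eigenspace (((bettiCohomology.map φE.hom.hom.hom 1).hom).baseChange ℂ) (starRingEnd ℂ (μ k)) ≤
      Module.End.eigenspace (((bettiCohomology.map φ.hom.hom.hom 1).hom).baseChange ℂ) (-(Complex.I * (Real.sqrt d : ℂ))))
    (hA'A : IsIsogenous A' A) : HodgeConjectureFor A'.dim A'.X := by
  haveI : HodgeTensorFacts.{0, 0} := hodgeTensorFacts_holds
  exact HodgeConjectureFor.of_isIsogenous hA'A
    (hodgeConjectureFor_weilType_generalE_of_markman₆_nonsplit A φ d hMark₆ hRW6 hW φE hC hdiag hQ hK J' hJ' hJQ hφQ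
      (hG_of_kWeil_cmAlgebra_twoMixed hW φE hE μ hinj hdist hmult
      (mixed_of_kWeil_cmAlgebra hW φE hE μ hinj hdist hmult k₁ k₂ hk₁₂ hι hKW) k₁ k₂ hk₁₂ hι hKW hKE hKE' hQ hK hφQ))

end Census

end Summit.HodgeConjecture.HodgeConjecture.TableX.WeilERows

end
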